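import Summits.QuantumFields.YangMills.Theorems.BalabanUVNodesN12FlatOneLevelGramExact
import Summits.QuantumFields.YangMills.Theorems.BalabanUVNodesN12FlatOneLevelGramExactSharp
import Literature.MathematicalPhysics.QuantumFieldTheory.Balaban1983to89.B6AvgWeightsKLevelV1
import Literature.MathematicalPhysics.QuantumFieldTheory.Balaban1983to89.B5Eq117TorusCarriers
import HarnessLib

/-!
# BalabanUVNodes ∕ N12 — (J-b) module H9: THE EXACT GRAM FLOOR OF THE `k`-FOLD STRAIGHT AVERAGE `Q_k = bondAvgIter k` (1.18) AND ITS OPTIMAL, `k`-UNIFORM RIGHT-INVERSE LETTER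
# `‖Q_kᵗg‖² ≥ (M²+2)∕(3M^{d+2})·‖g‖²`, `M = L^k` (sharp), hence `∃ H`, `Q_kH = 1`, `‖Hv‖² ≤ 3M^{d+2}∕(M²+2)·‖v‖²`; for `L^k•Q_k`: `3M^d∕(M²+2)` — in η-units `ρ² ≤ 3M²∕(M²+2) < 3`, UNIFORM IN `k`, `L`, VOLUME

Cell `pub-ymgap` (HUMAN RULINGS D-0062 ∕ D-0149), width seat `pub-ymgap-dag-n10-w1` g5 (module H8 `…N12FlatOneLevelGramExact` p634500 = the one-level edition, whose §1∕§3 lemmas are stated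
for a general block side `M` precisely so that this file can call them with `M = L^k`).  `--kind proof --supports stmt-QuantumFields-27364 --as helper` (K1⁹, KEY MAP v2); count-neutral;
THEOREMS ONLY (0 `def`, 0 `sorry`, 0 `instance`, 0 `notation`).  The STRAIGHT rung of item (i-c) of the seat's LOCATED-RHO-2 (INBOX 2026-08-28 l.≈36157) at ALL levels: the `k`-fold
straight average from `T_η = T^{(0)}` to `T^{(k)}` — the straight part `L^k·Q_k` of the record's true linearisation `Q^{(k)} = L^k·Q_k − dΛ_k` — has a right inverse whose bond-`ℓ²`
letter in print's η-units is `O(1)` uniformly in `k`; the comb term and the reading-(b) multi-level family (print's (46), J-C's `ρc` at `Bj M₁ Z k`) remain OPEN and crux-sized.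

THE COMPUTATION (= H8's with `L ↦ M = L^k`, legitimate by p39's one-stroke formula `B5Eq118OneStroke.bondAvgIter_eq_blockSum`: `(Q_kY)(c) = M^{−(d+1)}·Σ_{x ∈ B^k(c₋)} Y([x, x + Me_μ])`).
For the fine bond `b = ⟨x, x + e_μ⟩` with `k`-block `y = B^k`-point of `x` and offset `u = x_μ mod M` along `μ`, the `M` straight contours through `b` start at `x − te_μ`, `t < M`
(dag-n06-i's `B6AvgWeightsKLevelV1.backSite`), inside `B^k(y)` for `t ≤ u` and inside `B^k(y − e_μ)` for `t > u` (`iterBlockOf_backSite_apply_self`); so (§2, the TENT PROFILE,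
cf. `B6AvgWeightsKLevelV1` §2 on r03's carriers) `(Q_kᵗg)(b) = M^{−(d+1)}·((u+1)·g⟨y, μ⟩ + (M−1−u)·g⟨y − e_μ, μ⟩)`; H8's one-direction inequality with side `M` and the re-indexing
of the fine bonds by (`k`-block, offset in `{0,…,M−1}^d`, direction) (`B5Eq117TorusCarriers.sum_iterBlock_eq`) give (§3) `Σ_b (Q_kᵗg)(b)² ≥ (M²+2)∕(3M^{d+2})·Σ_c g(c)²`, attained at
the alternating data of `T^{(k)}` (§5), whence (§4, H5 §1) the right inverses with the optimal letters.

CONSUMED BY NAME, nothing modified: H8 (`sum_sq_affine_unshift_ge`, `const_eq`, `sum_offsets_sq_offset`), H5 (`exists_rightInverse_of_gram_floor`), H8b (`exists_alternating_ne_zero`),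
p39 `B5Eq118OneStroke` (`bondAvgIter_eq_blockSum`, `iterBlock`, `mem_iterBlock`, `iterBlockOf`), dag-n06-i `B6AvgWeightsKLevelV1` §1 (`muOff`, `backSite`, `runSite_eq_iff`,
`iterBlockOf_backSite_apply_self∕_ne`, `muOff_lt`), `B5Eq117TorusCarriers` (`blockSiteK`, `val_blockSiteK`, `blockSiteK_mem_iterBlock`, `sum_iterBlock_eq`), `BIJ85AxialPropagator411`
(`bondAvgIter_add∕_smul`), UST re-indexing (`Prop7FlatCurlCurl.sum_bond_eq_sum_site_dir`), the tree's `Literature.Probability.Percolation.sum_sum_sum_comm`.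

CONTENTS (ns `Summit.QuantumFields.YangMills.BalabanUVNodes.N12FlatIterGramExact`).  §1 `bondAvgIter_eq_sum_kernel`, `sum_site_eq_sum_iterBlock`, `iterBlockOf_blockSiteK`, `muOff_blockSiteK`.
§2 `iterBlockOf_backSite_eq`, ★★ `sum_kernel_iter_mul_eq` (THE TENT PROFILE of `Q_kᵗ`).  §3 `gram_iter_eq_sum_dir`, `pow_side`, ★★★ `gram_floor_bondAvgIter_exact`.
§4 ★★★ `exists_rightInverse_bondAvgIter_sq_le_exact` (`3M^{d+2}∕(M²+2)`), ★★★ `exists_rightInverse_smul_bondAvgIter_sq_le_exact` (`L^k•Q_k`: `3M^d∕(M²+2)`; η-units `ρ² < 3` for every `k`).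
§5 ★★ `gram_iter_eq_of_alternating`, ★★ `letter_floor_iter_of_alternating`, ★★★ `exists_datum_letter_floor_iter` (optimality at the alternating data of `T^{(k+1)}`, H8b `exists_alternating_ne_zero`).

HONEST FRAMING.  Finite-dimensional linear algebra + lattice bookkeeping at the FLAT configuration on the tree's own straight averages; real fields; whole torus `T^{(0)} → T^{(k)}`, TOP level
only (one `k`, not the multi-level family), no comb term `dΛ_k`, no region; the multi-level ∕ reading-(b) ∕ comb Gram floor (print's [Balaban1985Variational] (46)) is OPEN and crux-sized;
nothing of Bałaban's asserted beyond this count; N12 ∕ N10 NOT discharged; K1⁹ NOT closed; count-neutral (typed 28∕28 · discharged 5∕27 unmoved); one finite 𝕋⁴ programme at fixed ε —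
R4 closes the conditional finite-𝕋⁴ rung `BalabanLadder.UV` only; the YM mass gap (Clay) is NOT proved by any of this; nothing continuum ∕ ℝ⁴ ∕ OS.
-/

noncomputable section
open scoped BigOperators
open Finset
namespace Summit.QuantumFields.YangMills.BalabanUVNodes.N12FlatIterGramExact

open Literature.MathematicalPhysics.QuantumFieldTheory.Balaban1983to89
open LatticeFieldCalculus (bondAvg bondAvgIter segSum runBond runSite)
open B10StarCount (shift_unshift unshift_shift shiftEquiv)
open B5Eq118OneStroke (iterBlock iterBlockOf mem_iterBlock bondAvgIter_eq_blockSum)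
open B6AvgWeightsKLevelV1 (muOff muOff_lt backSite runSite_backSite runSite_eq_iff iterBlockOf_backSite_apply_self iterBlockOf_backSite_apply_ne)
open B5Eq117TorusCarriers (blockSiteK val_blockSiteK blockSiteK_mem_iterBlock sum_iterBlock_eq)
open Literature.MathematicalPhysics.QuantumFieldTheory.BalabanImbrieJaffe1984to88.BIJ85AxialPropagator411 (bondAvgIter_add bondAvgIter_smul)
open Summit.QuantumFields.YangMills.Theorems.Prop7FlatCurlCurl (sum_bond_eq_sum_site_dir)
open Summit.QuantumFields.YangMills.BalabanUVNodes.N12FlatOneLevelGramRightInverse (exists_rightInverse_of_gram_floor)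
open Summit.QuantumFields.YangMills.BalabanUVNodes.N12FlatOneLevelGramExact (sum_sq_affine_unshift_ge const_eq sum_offsets_sq_offset)
open Summit.QuantumFields.YangMills.BalabanUVNodes.N12FlatOneLevelGramExactSharp (exists_alternating_ne_zero)

variable {P : Params} {k : ℕ}

/-! ## §1  The `k`-fold average through its kernel; fine sites by (`k`-block, offset) -/

section Kernel

/-- **THE `k`-FOLD STRAIGHT AVERAGE THROUGH ITS KERNEL** (real fields): `(Q_kY)(c) = Σ_b (Q_k e_b)(c)·Y(b)` (linearity of (1.18)). [cite: Balaban1984PropagatorsI, (1.18) p.20] -/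
theorem bondAvgIter_eq_sum_kernel [DecidableEq (PBond P 0)] (Y : VecField P 0 ℝ) (c : PBond P k) :
    bondAvgIter k Y c = ∑ b, bondAvgIter k (Pi.single b (1 : ℝ)) c * Y b := by
  have hY : Y = ∑ b, Y b • (Pi.single b (1 : ℝ) : VecField P 0 ℝ) := by
    funext b'
    rw [Finset.sum_apply, Finset.sum_eq_single b' (fun b _ hb => by rw [Pi.smul_apply, Pi.single_eq_of_ne' hb, smul_zero])
      (fun h => absurd (Finset.mem_univ _) h), Pi.smul_apply, Pi.single_eq_same, smul_eq_mul, mul_one]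
  let QL : VecField P 0 ℝ →ₗ[ℝ] VecField P k ℝ :=
    { toFun := bondAvgIter k
      map_add' := bondAvgIter_add k
      map_smul' := bondAvgIter_smul k }
  have hQL : ∀ Z : VecField P 0 ℝ, QL Z = bondAvgIter k Z := fun _ => rfl
  have hlin : bondAvgIter k (∑ b, Y b • (Pi.single b (1 : ℝ) : VecField P 0 ℝ)) = ∑ b, Y b • bondAvgIter k (Pi.single b (1 : ℝ) : VecField P 0 ℝ) := by
    have h := map_sum QL (fun b => Y b • (Pi.single b (1 : ℝ) : VecField P 0 ℝ)) Finset.univ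
    simp only [hQL] at h
    simp only [bondAvgIter_smul] at h
    exact h
  conv_lhs => rw [hY]
  rw [hlin, Finset.sum_apply]
  exact Finset.sum_congr rfl fun b _ => by rw [Pi.smul_apply, smul_eq_mul, mul_comm]

/-- The finest lattice summed `k`-block by `k`-block: `Σ_x F(x) = Σ_{y ∈ T^{(k)}} Σ_{x ∈ B^k(y)} F(x)`. [cite: Balaban1984PropagatorsI, (1.18) p.20] -/
theorem sum_site_eq_sum_iterBlock {α : Type*} [AddCommMonoid α] (F : Site P 0 → α) :
    ∑ x, F x = ∑ y : Site P k, ∑ x ∈ iterBlock k y, F x := by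
  rw [← Finset.sum_fiberwise_of_maps_to (s := Finset.univ) (t := Finset.univ) (g := iterBlockOf k) (fun _ _ => Finset.mem_univ _) F]
  rfl

/-- The `k`-block of a block point is its label. [cite: Balaban1984PropagatorsI, (1.18) p.20] -/
theorem iterBlockOf_blockSiteK (hk : k ≤ P.m + P.K) (y : Site P k) (r : Fin P.d → Fin (P.L ^ k)) : iterBlockOf k (blockSiteK k y r) = y :=
  (mem_iterBlock k y _).1 (blockSiteK_mem_iterBlock hk y r)

/-- The offset of a block point along `μ` is its `μ`-offset. [cite: Balaban1984PropagatorsI, (1.18) p.20] -/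
theorem muOff_blockSiteK (hk : k ≤ P.m + P.K) (y : Site P k) (r : Fin P.d → Fin (P.L ^ k)) (μ : Fin P.d) : muOff k (blockSiteK k y r) μ = r μ := by
  unfold muOff
  rw [val_blockSiteK hk, Nat.mul_add_mod', Nat.mod_eq_of_lt (r μ).isLt]

/-! ## §2  The transpose kernel of the `k`-fold straight average: the tent profile -/

/-- The `k`-block of `x − te_μ` (`t ≤ M = L^k`): `B^k`-point of `x` if `t ≤ u = x_μ mod M`, its `μ`-predecessor otherwise (dag-n06-i's coordinatewise statements assembled).
[cite: Balaban1984PropagatorsI, (1.6) p.18, (1.18) p.20] -/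
theorem iterBlockOf_backSite_eq (hk : k ≤ P.m + P.K) (x : Site P 0) (μ : Fin P.d) {t : ℕ} (ht : t ≤ P.L ^ k) :
    iterBlockOf k (backSite x μ t) = if t ≤ muOff k x μ then iterBlockOf k x else (iterBlockOf k x).unshift μ := by
  funext ν
  by_cases hν : ν = μ
  · subst hν
    rw [iterBlockOf_backSite_apply_self hk x ν ht]
    by_cases h : t ≤ muOff k x ν
    · rw [if_pos h, if_neg (by omega), sub_zero]
    · rw [if_neg h, if_pos (by omega)]
      simp [Site.unshift]
  · rw [iterBlockOf_backSite_apply_ne hk x hν]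
    split_ifs
    · rfl
    · simp [Site.unshift, Function.update_of_ne hν]

/-- ★★ **THE TRANSPOSE KERNEL OF THE `k`-FOLD STRAIGHT AVERAGE (1.18) — THE TENT PROFILE.**  For the fine bond `b = ⟨x, x + e_μ⟩` with `k`-block `y` and `μ`-offset `u` (`M = L^k`) and
any field `g` on the bonds of `T^{(k)}`: `Σ_c (Q_k e_b)(c)·g(c) = M^{−(d+1)}·((u + 1)·g⟨y, μ⟩ + (M − 1 − u)·g⟨y − e_μ, μ⟩)` — the `M` straight contours through `b` start `t = 0,…,M−1`
steps behind `x`, for each `t` the pair (coarse bond, starting site) is unique, and the starting block is `B^k(y)` for `t ≤ u`, `B^k(y − e_μ)` for `t > u`.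
[cite: Balaban1984PropagatorsI, (1.18) p.20] -/
theorem sum_kernel_iter_mul_eq [DecidableEq (PBond P 0)] (hk : k ≤ P.m + P.K) (g : VecField P k ℝ) (x : Site P 0) (μ : Fin P.d) :
    ∑ c : PBond P k, bondAvgIter k (Pi.single (⟨x, μ⟩ : PBond P 0) (1 : ℝ)) c * g c =
      (((P.L : ℝ) ^ (P.d + 1)) ^ k)⁻¹ *
        ((((muOff k x μ : ℕ) : ℝ) + 1) * g ⟨iterBlockOf k x, μ⟩ + (((P.L ^ k : ℕ) : ℝ) - 1 - (muOff k x μ : ℕ)) * g ⟨(iterBlockOf k x).unshift μ, μ⟩) := by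
  classical
  set b : PBond P 0 := ⟨x, μ⟩ with hb
  set M : ℕ := P.L ^ k with hM
  have hu : muOff k x μ < M := muOff_lt k x μ
  -- Steps 1–2: the kernel through indicator sums, `t` outermost
  have h1 : ∀ c : PBond P k, bondAvgIter k (Pi.single b (1 : ℝ)) c * g c =
      (((P.L : ℝ) ^ (P.d + 1)) ^ k)⁻¹ * ∑ x' ∈ iterBlock k c.src, ∑ t ∈ Finset.range M, (if runBond x' c.dir t = b then g c else 0) := fun c => by
    rw [bondAvgIter_eq_blockSum k hk]
    simp only [segSum, Pi.single_apply, smul_eq_mul, mul_assoc, Finset.sum_mul, boole_mul, hM]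
  have h2 : ∑ c : PBond P k, bondAvgIter k (Pi.single b (1 : ℝ)) c * g c =
      (((P.L : ℝ) ^ (P.d + 1)) ^ k)⁻¹ * ∑ t ∈ Finset.range M, ∑ c : PBond P k, ∑ x' ∈ iterBlock k c.src, (if runBond x' c.dir t = b then g c else 0) := by
    simp only [h1, ← Finset.mul_sum]
    congr 1
    have hA : ∀ c : PBond P k, ∑ x' ∈ iterBlock k c.src, ∑ t ∈ Finset.range M, (if runBond x' c.dir t = b then g c else 0) =
        ∑ t ∈ Finset.range M, ∑ x' ∈ iterBlock k c.src, (if runBond x' c.dir t = b then g c else 0) := fun c => Finset.sum_comm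
    simp only [hA]
    exact Finset.sum_comm
  -- Step 3: for each `t` exactly one (coarse bond, starting site) pair has its contour's `t`-th bond equal to `b`
  have h3 : ∀ t, ∑ c : PBond P k, ∑ x' ∈ iterBlock k c.src, (if runBond x' c.dir t = b then g c else 0) = g ⟨iterBlockOf k (backSite x μ t), μ⟩ := by
    intro t
    have hiff : ∀ (c : PBond P k) (x' : Site P 0), runBond x' c.dir t = b ↔ x' = backSite x μ t ∧ c.dir = μ := by
      intro c x'
      constructor
      · intro h
        have hdir : c.dir = μ := by have := congrArg PBond.dir h; simpa [runBond, hb] using this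
        have hsrc : runSite x' c.dir t = x := by have := congrArg PBond.src h; simpa [runBond, hb] using this
        rw [hdir] at hsrc
        exact ⟨(runSite_eq_iff x' x μ t).1 hsrc, hdir⟩
      · rintro ⟨hx', hdir⟩
        simp only [runBond, hdir, hx', runSite_backSite, hb]
    simp only [hiff, ite_and, Finset.sum_ite_eq', mem_iterBlock]
    have hiff2 : ∀ c : PBond P k, (iterBlockOf k (backSite x μ t) = c.src ∧ c.dir = μ) ↔ c = ⟨iterBlockOf k (backSite x μ t), μ⟩ := by
      rintro ⟨s, ν⟩
      simp only [PBond.mk.injEq]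
      constructor
      · rintro ⟨h1, h2⟩; exact ⟨h1.symm, h2⟩
      · rintro ⟨h1, h2⟩; exact ⟨h1.symm, h2⟩
    simp only [← ite_and, hiff2, Finset.sum_ite_eq', Finset.mem_univ, if_true]
  -- Step 4: the starting block; Step 5: count
  have h5 : ∑ t ∈ Finset.range M, g ⟨iterBlockOf k (backSite x μ t), μ⟩ =
      (((muOff k x μ : ℕ) : ℝ) + 1) * g ⟨iterBlockOf k x, μ⟩ + (((M : ℕ) : ℝ) - 1 - (muOff k x μ : ℕ)) * g ⟨(iterBlockOf k x).unshift μ, μ⟩ := by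
    have hsplit := Finset.sum_Ico_consecutive (fun t => g ⟨iterBlockOf k (backSite x μ t), μ⟩) (Nat.zero_le (muOff k x μ + 1)) (by omega : muOff k x μ + 1 ≤ M)
    rw [Finset.range_eq_Ico, ← hsplit]
    have hA : ∑ t ∈ Finset.Ico 0 (muOff k x μ + 1), g ⟨iterBlockOf k (backSite x μ t), μ⟩ = ∑ t ∈ Finset.Ico 0 (muOff k x μ + 1), g ⟨iterBlockOf k x, μ⟩ :=
      Finset.sum_congr rfl fun t ht => by
        have := Finset.mem_Ico.mp ht; rw [iterBlockOf_backSite_eq hk x μ (by omega), if_pos (by omega)]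
    have hB : ∑ t ∈ Finset.Ico (muOff k x μ + 1) M, g ⟨iterBlockOf k (backSite x μ t), μ⟩ = ∑ t ∈ Finset.Ico (muOff k x μ + 1) M, g ⟨(iterBlockOf k x).unshift μ, μ⟩ :=
      Finset.sum_congr rfl fun t ht => by
        have := Finset.mem_Ico.mp ht; rw [iterBlockOf_backSite_eq hk x μ (by omega), if_neg (by omega)]
    rw [hA, hB, Finset.sum_const, Finset.sum_const, Nat.card_Ico, Nat.card_Ico, nsmul_eq_mul, nsmul_eq_mul, Nat.sub_zero,
      Nat.cast_sub (by omega : muOff k x μ + 1 ≤ M)]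
    push_cast
    ring
  rw [h2, Finset.sum_congr rfl fun t _ => h3 t, h5]

end Kernel

/-! ## §3  The exact Gram floor of `Q_k` -/

section Gram

/-- The Gram form of `Q_k` direction by direction, over (`k`-block, offset): `Σ_b (Q_kᵗg)(b)² = Σ_μ M^{−2(d+1)}·Σ_y Σ_{r ∈ {0,…,M−1}^d} ((r_μ+1)g⟨y,μ⟩ + (M−1−r_μ)g⟨y−e_μ,μ⟩)²`.
[cite: Balaban1984PropagatorsI, (1.18) p.20] -/
theorem gram_iter_eq_sum_dir [DecidableEq (PBond P 0)] (hk : k ≤ P.m + P.K) (g : VecField P k ℝ) :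
    ∑ b : PBond P 0, (∑ c, bondAvgIter k (Pi.single b (1 : ℝ)) c * g c) ^ 2 =
      ∑ μ : Fin P.d, ((((P.L : ℝ) ^ (P.d + 1)) ^ k)⁻¹) ^ 2 * ∑ y : Site P k, ∑ r : Fin P.d → Fin (P.L ^ k),
        ((((r μ : ℕ) : ℝ) + 1) * g ⟨y, μ⟩ + (((P.L ^ k : ℕ) : ℝ) - 1 - (r μ : ℕ)) * g ⟨y.unshift μ, μ⟩) ^ 2 := by
  rw [sum_bond_eq_sum_site_dir, Finset.sum_comm]
  refine Finset.sum_congr rfl fun μ _ => ?_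
  rw [sum_site_eq_sum_iterBlock (k := k), Finset.mul_sum]
  refine Finset.sum_congr rfl fun y _ => ?_
  rw [sum_iterBlock_eq hk, Finset.mul_sum]
  refine Finset.sum_congr rfl fun r _ => ?_
  rw [sum_kernel_iter_mul_eq hk g (blockSiteK k y r) μ, iterBlockOf_blockSiteK hk, muOff_blockSiteK hk, mul_pow]

/-- `(L^{d+1})^k = M^{d+1}`, `M = L^k`, as reals. [folklore] -/
theorem pow_side (P : Params) (k : ℕ) : ((P.L : ℝ) ^ (P.d + 1)) ^ k = (((P.L ^ k : ℕ) : ℝ)) ^ (P.d + 1) := by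
  push_cast
  exact pow_right_comm _ _ _

/-- ★★★ **THE EXACT GRAM FLOOR OF THE `k`-FOLD STRAIGHT AVERAGE**: `(M²+2)∕(3M^{d+2})·Σ_c g(c)² ≤ Σ_b (Q_kᵗg)(b)²`, `M = L^k` — print's optimal constant for the straight `k`-fold
average (the test-field ∕ far-face lineage gives `M^{−(d+1)}`-type floors); attained at the alternating data of `T^{(k)}` (§5). [cite: Balaban1985Variational, (44)-(46) p.285; Balaban1984PropagatorsI, (1.18) p.20] -/
theorem gram_floor_bondAvgIter_exact [DecidableEq (PBond P 0)] (hk : k ≤ P.m + P.K) (g : VecField P k ℝ) :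
    ((((P.L ^ k : ℕ) : ℝ)) ^ 2 + 2) / (3 * (((P.L ^ k : ℕ) : ℝ)) ^ (P.d + 2)) * ∑ c, g c ^ 2 ≤
      ∑ b : PBond P 0, (∑ c, bondAvgIter k (Pi.single b (1 : ℝ)) c * g c) ^ 2 := by
  have hM : P.L ^ k ≠ 0 := pow_ne_zero k P.L_pos.ne'
  have hsq : ∑ c, g c ^ 2 = ∑ μ : Fin P.d, ∑ y : Site P k, g ⟨y, μ⟩ ^ 2 := by rw [sum_bond_eq_sum_site_dir, Finset.sum_comm]
  rw [gram_iter_eq_sum_dir hk g, hsq, Finset.mul_sum]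
  refine Finset.sum_le_sum fun μ _ => ?_
  rw [const_eq (P := P) hM μ, mul_assoc, pow_side P k]
  exact mul_le_mul_of_nonneg_left (sum_sq_affine_unshift_ge (P.L ^ k) μ (fun y => g ⟨y, μ⟩)) (by positivity)

end Gram

/-! ## §4  The right inverses of `Q_k` and `L^k•Q_k` with the optimal, `k`-uniform letters -/

section RightInverse

/-- ★★★ **A LINEAR RIGHT INVERSE OF THE `k`-FOLD STRAIGHT AVERAGE WITH THE OPTIMAL bond-`ℓ²` LETTER**: `∃ H`, `Q_k(Hv) = v`, `Σ_b (Hv)(b)² ≤ 3M^{d+2}∕(M²+2)·Σ_c v(c)²`, `M = L^k`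
(H5 §1 with §3's floor; the minimal-norm solution). [cite: Balaban1985Variational, (44)-(46) p.285; Balaban1984PropagatorsI, (1.18) p.20] -/
theorem exists_rightInverse_bondAvgIter_sq_le_exact (hk : k ≤ P.m + P.K) :
    ∃ H : VecField P k ℝ →ₗ[ℝ] VecField P 0 ℝ, (∀ v, bondAvgIter k (H v) = v) ∧
      ∀ v, ∑ b, (H v b) ^ 2 ≤ (3 * (((P.L ^ k : ℕ) : ℝ)) ^ (P.d + 2) / ((((P.L ^ k : ℕ) : ℝ)) ^ 2 + 2)) * ∑ c, (v c) ^ 2 := by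
  classical
  have hMpos : (0 : ℝ) < ((P.L ^ k : ℕ) : ℝ) := by have := P.L_pos; positivity
  have hc₀ : (0 : ℝ) < ((((P.L ^ k : ℕ) : ℝ)) ^ 2 + 2) / (3 * (((P.L ^ k : ℕ) : ℝ)) ^ (P.d + 2)) := by positivity
  obtain ⟨H, hH, hHle⟩ := exists_rightInverse_of_gram_floor (fun (c : PBond P k) (b : PBond P 0) => bondAvgIter k (Pi.single b (1 : ℝ)) c) hc₀
    (fun g => gram_floor_bondAvgIter_exact hk g)
  refine ⟨H, fun v => funext fun c => ?_, fun v => ?_⟩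
  · rw [bondAvgIter_eq_sum_kernel]; exact hH v c
  · have := hHle v; rwa [inv_div] at this

/-- ★★★ **THE SAME FOR `L^k•Q_k`, THE STRAIGHT PART OF THE TRUE LINEARISATION `Q^{(k)} = L^k·Q_k − dΛ_k`**: `∃ H′` linear, `L^k•Q_k(H′v) = v`, `Σ_b (H′v)(b)² ≤ 3M^d∕(M²+2)·Σ_c v(c)²`,
`M = L^k` — in print's η-units at the top level (weight `(L^{d−2})^k = M^{d−2}`, the Defs file's `levelWeight P k`) the letter is `ρ² ≤ 3M²∕(M²+2) < 3`: UNIFORM IN `k`, in `L` and in the volume.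
(The comb term `dΛ_k` and the lower-level rows of the reading-(b) family are NOT here — that is print's (46), open.) [cite: Balaban1985Variational, (44)-(46) p.285; Balaban1985Averaging, (124)-(125) p.36] -/
theorem exists_rightInverse_smul_bondAvgIter_sq_le_exact (hk : k ≤ P.m + P.K) :
    ∃ H' : VecField P k ℝ →ₗ[ℝ] VecField P 0 ℝ, (∀ v, ((P.L : ℝ) ^ k) • bondAvgIter k (H' v) = v) ∧
      ∀ v, ∑ b, (H' v b) ^ 2 ≤ (3 * (((P.L ^ k : ℕ) : ℝ)) ^ P.d / ((((P.L ^ k : ℕ) : ℝ)) ^ 2 + 2)) * ∑ c, (v c) ^ 2 := by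
  have hL : (P.L : ℝ) ^ k ≠ 0 := pow_ne_zero k (Nat.cast_ne_zero.mpr P.L_pos.ne')
  have hM : ((P.L ^ k : ℕ) : ℝ) ≠ 0 := by exact_mod_cast pow_ne_zero k P.L_pos.ne'
  obtain ⟨H, hH, hHle⟩ := exists_rightInverse_bondAvgIter_sq_le_exact (P := P) hk
  refine ⟨((P.L : ℝ) ^ k)⁻¹ • H, fun v => ?_, fun v => ?_⟩
  · rw [LinearMap.smul_apply, bondAvgIter_smul, hH, smul_smul, mul_inv_cancel₀ hL, one_smul]
  · have h1 : ∀ b, ((((P.L : ℝ) ^ k)⁻¹ • H) v b) ^ 2 = ((((P.L ^ k : ℕ) : ℝ)) ^ 2)⁻¹ * (H v b) ^ 2 := fun b => by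
      rw [LinearMap.smul_apply, Pi.smul_apply, smul_eq_mul, mul_pow, inv_pow]; push_cast; ring
    simp only [h1, ← Finset.mul_sum]
    calc ((((P.L ^ k : ℕ) : ℝ)) ^ 2)⁻¹ * ∑ b, H v b ^ 2
        ≤ ((((P.L ^ k : ℕ) : ℝ)) ^ 2)⁻¹ * ((3 * (((P.L ^ k : ℕ) : ℝ)) ^ (P.d + 2) / ((((P.L ^ k : ℕ) : ℝ)) ^ 2 + 2)) * ∑ c, v c ^ 2) :=
          mul_le_mul_of_nonneg_left (hHle v) (by positivity)
      _ = (3 * (((P.L ^ k : ℕ) : ℝ)) ^ P.d / ((((P.L ^ k : ℕ) : ℝ)) ^ 2 + 2)) * ∑ c, v c ^ 2 := by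
          rw [← mul_assoc]
          congr 1
          field_simp
          ring

end RightInverse

/-! ## §5  Sharpness at the alternating data of `T^{(k)}` -/

section Sharp

/-- ★★ **THE GRAM FORM OF `Q_k` ATTAINS THE FLOOR AT EVERY ALTERNATING DATUM** `g⟨y − e_μ, μ⟩ = −g⟨y, μ⟩` of `T^{(k)}` (these exist with `g² ≡ 1` whenever `k ≥ 1`, H8b `exists_alternating_ne_zero`).
[cite: Balaban1985Variational, (44)-(46) p.285] -/
theorem gram_iter_eq_of_alternating [DecidableEq (PBond P 0)] (hk : k ≤ P.m + P.K) (g : VecField P k ℝ)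
    (hg : ∀ (y : Site P k) (μ : Fin P.d), g ⟨y.unshift μ, μ⟩ = -g ⟨y, μ⟩) :
    ∑ b : PBond P 0, (∑ c, bondAvgIter k (Pi.single b (1 : ℝ)) c * g c) ^ 2 =
      ((((P.L ^ k : ℕ) : ℝ)) ^ 2 + 2) / (3 * (((P.L ^ k : ℕ) : ℝ)) ^ (P.d + 2)) * ∑ c, g c ^ 2 := by
  have hM : P.L ^ k ≠ 0 := pow_ne_zero k P.L_pos.ne'
  have hsq0 : ∑ c, g c ^ 2 = ∑ μ : Fin P.d, ∑ y : Site P k, g ⟨y, μ⟩ ^ 2 := by rw [sum_bond_eq_sum_site_dir, Finset.sum_comm]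
  rw [gram_iter_eq_sum_dir hk g, hsq0, Finset.mul_sum]
  refine Finset.sum_congr rfl fun μ _ => ?_
  have hsq : ∀ (y : Site P k) (r : Fin P.d → Fin (P.L ^ k)),
      ((((r μ : ℕ) : ℝ) + 1) * g ⟨y, μ⟩ + (((P.L ^ k : ℕ) : ℝ) - 1 - (r μ : ℕ)) * g ⟨y.unshift μ, μ⟩) ^ 2 =
        (2 * ((r μ : ℕ) : ℝ) + 2 - ((P.L ^ k : ℕ) : ℝ)) ^ 2 * g ⟨y, μ⟩ ^ 2 := fun y r => by rw [hg]; ring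
  rw [const_eq (P := P) hM μ, mul_assoc, pow_side P k]
  congr 1
  simp only [hsq, ← Finset.sum_mul, sum_offsets_sq_offset (P.L ^ k) μ]
  rw [Finset.mul_sum]

/-- ★★ **EVERY PREIMAGE OF AN ALTERNATING DATUM COSTS THE FULL LETTER**: `Q_kY = g`, `g` alternating ⟹ `3M^{d+2}∕(M²+2)·Σ_c g(c)² ≤ Σ_b Y(b)²` — §4's constant is optimal for every `k`.
[cite: Balaban1985Variational, (44)-(46) p.285; Balaban1984PropagatorsI, (1.18) p.20] -/
theorem letter_floor_iter_of_alternating (hk : k ≤ P.m + P.K) (g : VecField P k ℝ)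
    (hg : ∀ (y : Site P k) (μ : Fin P.d), g ⟨y.unshift μ, μ⟩ = -g ⟨y, μ⟩) (Y : VecField P 0 ℝ) (hY : bondAvgIter k Y = g) :
    (3 * (((P.L ^ k : ℕ) : ℝ)) ^ (P.d + 2) / ((((P.L ^ k : ℕ) : ℝ)) ^ 2 + 2)) * ∑ c, g c ^ 2 ≤ ∑ b, Y b ^ 2 := by
  classical
  have hMpos : (0 : ℝ) < ((P.L ^ k : ℕ) : ℝ) := by have := P.L_pos; positivity
  set c₀ : ℝ := ((((P.L ^ k : ℕ) : ℝ)) ^ 2 + 2) / (3 * (((P.L ^ k : ℕ) : ℝ)) ^ (P.d + 2)) with hc₀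
  have hc₀pos : 0 < c₀ := by positivity
  set T : PBond P 0 → ℝ := fun b => ∑ c, bondAvgIter k (Pi.single b (1 : ℝ)) c * g c with hT
  set S : ℝ := ∑ c, g c ^ 2 with hS
  have hS0 : 0 ≤ S := Finset.sum_nonneg fun c _ => sq_nonneg _
  have hSY : S = ∑ b, Y b * T b := by
    have h1 : S = ∑ c, bondAvgIter k Y c * g c := by
      rw [hS, hY]; exact Finset.sum_congr rfl fun c _ => by ring
    have h2 : ∀ c, bondAvgIter k Y c = ∑ b, bondAvgIter k (Pi.single b (1 : ℝ)) c * Y b := fun c => bondAvgIter_eq_sum_kernel Y c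
    rw [h1]
    simp only [h2, hT, Finset.sum_mul, Finset.mul_sum]
    rw [Finset.sum_comm]
    exact Finset.sum_congr rfl fun b _ => Finset.sum_congr rfl fun c _ => by ring
  have hTT : ∑ b, T b ^ 2 = c₀ * S := gram_iter_eq_of_alternating hk g hg
  have hCS : S ^ 2 ≤ (∑ b, Y b ^ 2) * ∑ b, T b ^ 2 := by rw [hSY]; exact Finset.sum_mul_sq_le_sq_mul_sq _ _ _
  rw [hTT] at hCS
  have hinv : 3 * (((P.L ^ k : ℕ) : ℝ)) ^ (P.d + 2) / ((((P.L ^ k : ℕ) : ℝ)) ^ 2 + 2) = c₀⁻¹ := by rw [hc₀, inv_div]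
  rw [hinv]
  by_cases hS' : S = 0
  · rw [hS', mul_zero]; exact Finset.sum_nonneg fun b _ => sq_nonneg _
  · have hSpos : 0 < S := lt_of_le_of_ne hS0 (Ne.symm hS')
    have h2 : S * S ≤ ((∑ b, Y b ^ 2) * c₀) * S := by
      calc S * S = S ^ 2 := (sq S).symm
        _ ≤ (∑ b, Y b ^ 2) * (c₀ * S) := hCS
        _ = ((∑ b, Y b ^ 2) * c₀) * S := by ring
    have h3 : S ≤ (∑ b, Y b ^ 2) * c₀ := le_of_mul_le_mul_right h2 hSpos
    calc c₀⁻¹ * S ≤ c₀⁻¹ * ((∑ b, Y b ^ 2) * c₀) := mul_le_mul_of_nonneg_left h3 (by positivity)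
      _ = ∑ b, Y b ^ 2 := by field_simp

/-- ★★★ **OPTIMALITY OF THE `k`-FOLD LETTER AT EVERY LEVEL `k + 1 ≥ 1`**: there is a field `g` on the bonds of `T^{(k+1)}` with `g(c)² = 1` everywhere (H8b's alternating datum) all of whose
preimages under `Q_{k+1}` cost the full letter: `Q_{k+1}Y = g → 3M^{d+2}∕(M²+2)·Σ_c g(c)² ≤ Σ_b Y(b)²`, `M = L^{k+1}` — no right inverse of `Q_{k+1}`, linear or not, beats §4.
[cite: Balaban1985Variational, (44)-(46) p.285; Balaban1984PropagatorsI, (1.18) p.20] -/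
theorem exists_datum_letter_floor_iter (hk : k + 1 ≤ P.m + P.K) :
    ∃ g : VecField P (k + 1) ℝ, (∀ c, g c ^ 2 = 1) ∧
      ∀ Y : VecField P 0 ℝ, bondAvgIter (k + 1) Y = g →
        (3 * (((P.L ^ (k + 1) : ℕ) : ℝ)) ^ (P.d + 2) / ((((P.L ^ (k + 1) : ℕ) : ℝ)) ^ 2 + 2)) * ∑ c, g c ^ 2 ≤ ∑ b, Y b ^ 2 := by
  obtain ⟨g, hg, hg1⟩ := exists_alternating_ne_zero P k
  exact ⟨g, hg1, fun Y hY => letter_floor_iter_of_alternating hk g hg Y hY⟩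

end Sharp

end Summit.QuantumFields.YangMills.BalabanUVNodes.N12FlatIterGramExact
end
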